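import Summits.AtomisticToContinuum.Crystallization.Theorems.FrustratedLawDichotomyStrainedPatchHomGram

/-!
# (P4) leaf soundness in EXTENDED GRAM COORDINATES — the hcp box floor (unshifted + shifted families)

Sequel of `…StrainedPatchHomGram` (decomp-a2c hand-1 g19; critic rows 764/769, CERT-DESIGN-g44 §1–2, device (D1)): the hcp box floor
`Σ_{b ∈ box} W ‖latPt U f b‖ + Σ_{b ∈ box'} W ‖latPt U f b + U t‖` (`t = hcpShift + ξ`) is a sum of univariate terms `W ∘ √` of LINEAR
functionals of the 13 extended Gram coordinates `cᵢⱼ = ⟪U fᵢ, U fⱼ⟫`, `dᵢ = ⟪U fᵢ, U t⟫`, `e = ‖U t‖²` (`norm_sq_latPt_add_eq_sum_gram`).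
This file (DEF-FREE): a coordinate-type-generic version of `…HomCentredForm.leaf_sound_box` (`leaf_sound_box_fintype`, any `Fintype` index),
the two summands in coordinates (`summand_eq_gramExt`, `summandShift_eq_gramExt`) and ★ `boxSumHcp_ge_of_gramLeaf`, the hcp C-leaf soundness
theorem with the checker's data.  `--supports stmt-AtomisticToContinuum-27623`.
-/

noncomputable section

namespace Summit.AtomisticToContinuum.Crystallization.Theorems.FrustratedLawDichotomyStrainedPatchHomGramHcp

open scoped BigOperators RealInnerProductSpace
open Set
open Summit.AtomisticToContinuum.Crystallization.Theorems.ChargedEnergyGapNegative (E3)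
open Summit.AtomisticToContinuum.Crystallization.Theorems.FrustratedLawDichotomyStrainedPatchHomSplit
open Summit.AtomisticToContinuum.Crystallization.Theorems.FrustratedLawDichotomyStrainedPatchHomCentredForm
open Summit.AtomisticToContinuum.Crystallization.Theorems.FrustratedLawDichotomyStrainedPatchHomGram

/-! ## §1. `leaf_sound_box` with an arbitrary finite coordinate type -/

/-- Box range of a linear functional, any finite coordinate type. [folklore] -/
theorem abs_linear_sub_le_fintype {κ : Type*} [Fintype κ] (L c c₀ w : κ → ℝ) (hbox : ∀ k, |c k - c₀ k| ≤ w k) :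
    |∑ k, L k * c k - ∑ k, L k * c₀ k| ≤ ∑ k, |L k| * w k := by
  rw [← Finset.sum_sub_distrib]
  calc |∑ k, (L k * c k - L k * c₀ k)| ≤ ∑ k, |L k * c k - L k * c₀ k| := Finset.abs_sum_le_sum_abs _ _
    _ = ∑ k, |L k| * |c k - c₀ k| := Finset.sum_congr rfl fun k _ => by rw [← mul_sub, abs_mul]
    _ ≤ ∑ k, |L k| * w k := Finset.sum_le_sum fun k _ => mul_le_mul_of_nonneg_left (hbox k) (abs_nonneg _)

/-- ★ **LEAF SOUNDNESS, self-ranging form, any finite coordinate type `κ`** (transport of `leaf_sound_box` along `κ ≃ Fin n`). [folklore] -/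
theorem leaf_sound_box_fintype {ι κ : Type*} [Fintype κ] (S : Finset ι) (L : ι → κ → ℝ) (φ φ' : ι → ℝ → ℝ) (M : ι → ℝ)
    (c₀ w : κ → ℝ) (m : ℝ) (hw : ∀ k, 0 ≤ w k) (hM : ∀ v ∈ S, 0 ≤ M v)
    (hd : ∀ v ∈ S, ∀ t ∈ Icc (∑ k, L v k * c₀ k - ∑ k, |L v k| * w k) (∑ k, L v k * c₀ k + ∑ k, |L v k| * w k),
      HasDerivAt (φ v) (φ' v t) t)
    (hmono : ∀ v ∈ S, MonotoneOn (fun t => φ' v t + M v * t)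
      (Icc (∑ k, L v k * c₀ k - ∑ k, |L v k| * w k) (∑ k, L v k * c₀ k + ∑ k, |L v k| * w k)))
    (hcheck : m ≤ ∑ v ∈ S, φ v (∑ k, L v k * c₀ k)
        - ∑ k, |∑ v ∈ S, φ' v (∑ j, L v j * c₀ j) * L v k| * w k
        - 1 / 2 * ∑ v ∈ S, M v * (∑ k, |L v k| * w k) ^ 2)
    (c : κ → ℝ) (hbox : ∀ k, |c k - c₀ k| ≤ w k) :
    m ≤ ∑ v ∈ S, φ v (∑ k, L v k * c k) := by
  classical
  set e := Fintype.equivFin κ with he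
  -- every `κ`-sum is the corresponding `Fin`-sum along `e`
  have hs : ∀ F : κ → ℝ, ∑ k, F k = ∑ i : Fin (Fintype.card κ), F (e.symm i) := fun F =>
    (Equiv.sum_comp e.symm F).symm
  -- the rewriting `hs` turns every `Fin`-sum back into the `κ`-sum it came from
  have h1 : ∀ v, ∑ i : Fin (Fintype.card κ), L v (e.symm i) * c₀ (e.symm i) = ∑ k, L v k * c₀ k :=
    fun v => (hs fun k => L v k * c₀ k).symm
  have h2 : ∀ v, ∑ i : Fin (Fintype.card κ), |L v (e.symm i)| * w (e.symm i) = ∑ k, |L v k| * w k :=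
    fun v => (hs fun k => |L v k| * w k).symm
  have h3 : ∀ v, ∑ i : Fin (Fintype.card κ), L v (e.symm i) * c (e.symm i) = ∑ k, L v k * c k :=
    fun v => (hs fun k => L v k * c k).symm
  have h4 : ∑ i : Fin (Fintype.card κ), |∑ v ∈ S, φ' v (∑ j, L v j * c₀ j) * L v (e.symm i)| * w (e.symm i) =
      ∑ k, |∑ v ∈ S, φ' v (∑ j, L v j * c₀ j) * L v k| * w k :=
    (hs fun k => |∑ v ∈ S, φ' v (∑ j, L v j * c₀ j) * L v k| * w k).symm
  have h' := leaf_sound_box S (fun v i => L v (e.symm i)) φ φ' M (fun i => c₀ (e.symm i)) (fun i => w (e.symm i)) m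
    (fun i => hw _) hM (by simpa only [h1, h2] using hd) (by simpa only [h1, h2] using hmono)
    (by simpa only [h1, h2, h4] using hcheck) (fun i => c (e.symm i)) (fun i => hbox _)
  simpa only [h3] using h'

/-! ## §2. The two hcp summands in the 13 extended Gram coordinates -/

/-- The linear functional of the UNSHIFTED summand: `bᵢbⱼ` on the Gram block, `0` elsewhere. [formal bookkeeping] -/
theorem summand_eq_gramExt (W : ℝ → ℝ) (U : E3 →L[ℝ] E3) (f : Fin 3 → E3) (t : E3) (b : Fin 3 → ℤ) :
    W ‖latPt U f b‖ = (fun q => W (Real.sqrt q))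
      (∑ k : (Fin 3 × Fin 3) ⊕ (Fin 3 ⊕ Fin 1),
        (Sum.elim (fun ij : Fin 3 × Fin 3 => ((b ij.1 : ℝ) * (b ij.2 : ℝ))) (fun _ => (0 : ℝ)) k) *
        (Sum.elim (fun ij : Fin 3 × Fin 3 => ⟪U (f ij.1), U (f ij.2)⟫)
          (Sum.elim (fun i : Fin 3 => ⟪U (f i), U t⟫) (fun _ => ‖U t‖ ^ 2)) k)) := by
  have hq : ∑ k : (Fin 3 × Fin 3) ⊕ (Fin 3 ⊕ Fin 1),
        (Sum.elim (fun ij : Fin 3 × Fin 3 => ((b ij.1 : ℝ) * (b ij.2 : ℝ))) (fun _ => (0 : ℝ)) k) *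
        (Sum.elim (fun ij : Fin 3 × Fin 3 => ⟪U (f ij.1), U (f ij.2)⟫)
          (Sum.elim (fun i : Fin 3 => ⟪U (f i), U t⟫) (fun _ => ‖U t‖ ^ 2)) k) = ‖latPt U f b‖ ^ 2 := by
    rw [Fintype.sum_sum_type]
    simp only [Sum.elim_inl, Sum.elim_inr, zero_mul, Finset.sum_const_zero, add_zero]
    rw [norm_sq_latPt_eq_sum_gram, ← Finset.sum_product', Finset.univ_product_univ]
  simp only [hq, Real.sqrt_sq (norm_nonneg _)]

/-- The linear functional of the SHIFTED summand: `bᵢbⱼ` on the Gram block, `2bᵢ` on the `d`-block, `1` on `e`. [formal bookkeeping] -/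
theorem summandShift_eq_gramExt (W : ℝ → ℝ) (U : E3 →L[ℝ] E3) (f : Fin 3 → E3) (t : E3) (b : Fin 3 → ℤ) :
    W ‖latPt U f b + U t‖ = (fun q => W (Real.sqrt q))
      (∑ k : (Fin 3 × Fin 3) ⊕ (Fin 3 ⊕ Fin 1),
        (Sum.elim (fun ij : Fin 3 × Fin 3 => ((b ij.1 : ℝ) * (b ij.2 : ℝ)))
          (Sum.elim (fun i : Fin 3 => 2 * (b i : ℝ)) (fun _ => (1 : ℝ))) k) *
        (Sum.elim (fun ij : Fin 3 × Fin 3 => ⟪U (f ij.1), U (f ij.2)⟫)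
          (Sum.elim (fun i : Fin 3 => ⟪U (f i), U t⟫) (fun _ => ‖U t‖ ^ 2)) k)) := by
  have hq : ∑ k : (Fin 3 × Fin 3) ⊕ (Fin 3 ⊕ Fin 1),
        (Sum.elim (fun ij : Fin 3 × Fin 3 => ((b ij.1 : ℝ) * (b ij.2 : ℝ)))
          (Sum.elim (fun i : Fin 3 => 2 * (b i : ℝ)) (fun _ => (1 : ℝ))) k) *
        (Sum.elim (fun ij : Fin 3 × Fin 3 => ⟪U (f ij.1), U (f ij.2)⟫)
          (Sum.elim (fun i : Fin 3 => ⟪U (f i), U t⟫) (fun _ => ‖U t‖ ^ 2)) k) = ‖latPt U f b + U t‖ ^ 2 := by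
    rw [Fintype.sum_sum_type, Fintype.sum_sum_type]
    simp only [Sum.elim_inl, Sum.elim_inr, Finset.univ_unique, Finset.sum_singleton, one_mul]
    rw [norm_sq_latPt_add_eq_sum_gram, ← Finset.sum_product', Finset.univ_product_univ, Finset.mul_sum]
    have e1 : ∑ i : Fin 3, 2 * (b i : ℝ) * ⟪U (f i), U t⟫ = ∑ i : Fin 3, 2 * ((b i : ℝ) * ⟪U (f i), U t⟫) :=
      Finset.sum_congr rfl fun i _ => by ring
    rw [e1]; ring
  simp only [hq, Real.sqrt_sq (norm_nonneg _)]

/-! ## §3. The hcp leaf -/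

/-- ★★ **(P4) hcp LEAF SOUNDNESS IN EXTENDED GRAM COORDINATES.**  Coordinates `κ = (Fin 3 × Fin 3) ⊕ Fin 3 ⊕ Fin 1` carrying
`(⟪U fᵢ, U fⱼ⟫, ⟪U fᵢ, U t⟫, ‖U t‖²)`; labels `box ⊕ box'` (unshifted ⊕ shifted family) with the linear functionals of §2; data
`(c₀, w, M, W′)` and the checker's inequality exactly as in `leaf_sound_box_fintype`.  Conclusion: for every deformation `U` and shift `t`
whose extended Gram data lie in the leaf box, `μ ≤ Σ_{b∈box} W ‖latPt U f b‖ + Σ_{b∈box'} W ‖latPt U f b + U t‖`. [folklore] -/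
theorem boxSumHcp_ge_of_gramLeaf (W W' : ℝ → ℝ) (box box' : Finset (Fin 3 → ℤ)) (f : Fin 3 → E3)
    (M : (Fin 3 → ℤ) ⊕ (Fin 3 → ℤ) → ℝ) (c₀ w : (Fin 3 × Fin 3) ⊕ (Fin 3 ⊕ Fin 1) → ℝ) (μ : ℝ)
    (hw : ∀ k, 0 ≤ w k) (hM : ∀ v ∈ box.disjSum box', 0 ≤ M v)
    (L : (Fin 3 → ℤ) ⊕ (Fin 3 → ℤ) → (Fin 3 × Fin 3) ⊕ (Fin 3 ⊕ Fin 1) → ℝ)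
    (hL : L = Sum.elim
      (fun b => Sum.elim (fun ij : Fin 3 × Fin 3 => ((b ij.1 : ℝ) * (b ij.2 : ℝ))) (fun _ => (0 : ℝ)))
      (fun b => Sum.elim (fun ij : Fin 3 × Fin 3 => ((b ij.1 : ℝ) * (b ij.2 : ℝ)))
        (Sum.elim (fun i : Fin 3 => 2 * (b i : ℝ)) (fun _ => (1 : ℝ)))))
    (hd : ∀ v ∈ box.disjSum box', ∀ s ∈ Icc (∑ k, L v k * c₀ k - ∑ k, |L v k| * w k) (∑ k, L v k * c₀ k + ∑ k, |L v k| * w k),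
      HasDerivAt (fun q => W (Real.sqrt q)) (W' s) s)
    (hmono : ∀ v ∈ box.disjSum box', MonotoneOn (fun s => W' s + M v * s)
      (Icc (∑ k, L v k * c₀ k - ∑ k, |L v k| * w k) (∑ k, L v k * c₀ k + ∑ k, |L v k| * w k)))
    (hcheck : μ ≤ ∑ v ∈ box.disjSum box', W (Real.sqrt (∑ k, L v k * c₀ k))
        - ∑ k, |∑ v ∈ box.disjSum box', W' (∑ j, L v j * c₀ j) * L v k| * w k
        - 1 / 2 * ∑ v ∈ box.disjSum box', M v * (∑ k, |L v k| * w k) ^ 2)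
    (U : E3 →L[ℝ] E3) (t : E3)
    (hbox : ∀ k, |(Sum.elim (fun ij : Fin 3 × Fin 3 => ⟪U (f ij.1), U (f ij.2)⟫)
      (Sum.elim (fun i : Fin 3 => ⟪U (f i), U t⟫) (fun _ => ‖U t‖ ^ 2)) k) - c₀ k| ≤ w k) :
    μ ≤ ∑ b ∈ box, W ‖latPt U f b‖ + ∑ b ∈ box', W ‖latPt U f b + U t‖ := by
  have h := leaf_sound_box_fintype (box.disjSum box') L (fun _ q => W (Real.sqrt q)) (fun _ s => W' s) M c₀ w μ hw hM hd hmono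
    hcheck _ hbox
  rw [Finset.sum_disjSum] at h
  subst hL
  simpa only [Sum.elim_inl, Sum.elim_inr, summand_eq_gramExt W U f t, summandShift_eq_gramExt W U f t] using h

end Summit.AtomisticToContinuum.Crystallization.Theorems.FrustratedLawDichotomyStrainedPatchHomGramHcp

end
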